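import Mathlib
import HarnessLib

/-!
# Levelwise antipodal Harris FAILS for disjunctions of connection events — the boundary of the Level Principle

Helper file for crux `stmt-CriticalPhenomena-4575` (new-inequality factory `prim-ineq-gen-1`, gen 12); memo
`run/shared/lean/prim/prim-ineq-gen-1/FINDING-18-graded-harris-modular-cuts.md` §0 (V1a), §2.

The Level Principle (FINDING-17/18) asserts that for two *connection events* (more generally two single-element extensions /
modular cuts of the cycle matroid) the antipodal Harris sum `∑ (1_A(W) − 1_A(Wᶜ))(1_B(W) − 1_B(Wᶜ))` is nonnegative on every
level `λ(W) = n + 1 − k(W) − k(Wᶜ)` separately.  This file certifies by kernel computation that the restriction to such events is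
necessary: on the multigraph with vertex set `{0,1,2,3}` and edge list `01, 03, 12, 23, 01` (a 4-cycle with one doubled edge) the
increasing events `A = [1 ↔ 2] ∨ [0 ↔ 3]` and `B = [0 ↔ 1] ∨ [2 ↔ 3]` have level sums `(+2, −2, 0)` on the levels
`k(W) + k(Wᶜ) = 5, 4, 3` — the middle level is negative (the total, `0`, is consistent with the ungraded Harris inequality).
(This work, 2026-08-20.)
-/

namespace Summit.CriticalPhenomena.PercolationContinuityZ3.Theorems

namespace LevelHarrisDisjunctionCex

open Finset

/-- Endpoints of the five edges `e₀ = 01, e₁ = 03, e₂ = 12, e₃ = 23, e₄ = 01` (parallel to `e₀`). [this work] -/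
def ends : Fin 5 → Fin 4 × Fin 4
  | ⟨0, _⟩ => (0, 1)
  | ⟨1, _⟩ => (0, 3)
  | ⟨2, _⟩ => (1, 2)
  | ⟨3, _⟩ => (2, 3)
  | ⟨4, _⟩ => (0, 1)

/-- Adjacency of two vertices in the spanning subgraph with edge set `W`. [this work] -/
def adj (W : Finset (Fin 5)) (x y : Fin 4) : Bool :=
  decide (∃ e ∈ W, (ends e = (x, y)) ∨ (ends e = (y, x)))

/-- Connectivity in the subgraph `W` (four vertices, so walks of length `≤ 3` suffice). [this work] -/
def conn (W : Finset (Fin 5)) (x y : Fin 4) : Bool :=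
  decide (x = y) || adj W x y || decide (∃ z : Fin 4, adj W x z && adj W z y) ||
    decide (∃ z w : Fin 4, adj W x z && adj W z w && adj W w y)

/-- Number of connected components of the subgraph `W` (count the vertices that are minimal in their component). [this work] -/
def ncomp (W : Finset (Fin 5)) : ℕ :=
  (univ.filter fun v : Fin 4 => ∀ u : Fin 4, u < v → conn W u v = false).card

/-- The event `A = [1 ↔ 2] ∨ [0 ↔ 3]`. [this work] -/
def evA (W : Finset (Fin 5)) : Bool := conn W 1 2 || conn W 0 3

/-- The event `B = [0 ↔ 1] ∨ [2 ↔ 3]`. [this work] -/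
def evB (W : Finset (Fin 5)) : Bool := conn W 0 1 || conn W 2 3

/-- Antipodal spin of a Boolean event at the colouring `(W, Wᶜ)`. [this work] -/
def bspin (ev : Finset (Fin 5) → Bool) (W : Finset (Fin 5)) : ℤ :=
  (if ev W then 1 else 0) - (if ev Wᶜ then 1 else 0)

/-- The antipodal Harris sum of `A` and `B` over the colourings with `k(W) + k(Wᶜ) = s`
(level `λ = 5 − s` of the Level Principle). [this work] -/
def levelSum (s : ℕ) : ℤ :=
  ∑ W ∈ (univ : Finset (Finset (Fin 5))).filter (fun W => ncomp W + ncomp Wᶜ = s), bspin evA W * bspin evB W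

/-- **The middle level is negative**: `∑_{k(W)+k(Wᶜ)=4} s_A(W) s_B(W) = −2`. [this work] -/
theorem levelSum_four : levelSum 4 = -2 := by decide

/-- The top level: `∑_{k(W)+k(Wᶜ)=5} s_A s_B = 2`. [this work] -/
theorem levelSum_five : levelSum 5 = 2 := by decide

/-- The bottom level: `∑_{k(W)+k(Wᶜ)=3} s_A s_B = 0`. [this work] -/
theorem levelSum_three : levelSum 3 = 0 := by decide

/-- Hence the levelwise antipodal Harris inequality fails for this pair of increasing (disjunctive) connection events:
some level sum is negative. [this work] -/
theorem exists_negative_level : ∃ s : ℕ, levelSum s < 0 := ⟨4, by rw [levelSum_four]; norm_num⟩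

end LevelHarrisDisjunctionCex

end Summit.CriticalPhenomena.PercolationContinuityZ3.Theorems
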